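import Summits.ResolutionOfSingularities.ResolutionOfSingularities.Theorems.MarkedTransferCampaignW13BypassRFlatInstances
import Literature.RingTheory.IntegralClosure.PrincipalReesIntegrallyClosed
import Mathlib.Algebra.MvPolynomial.PDeriv
import Mathlib.Algebra.MvPolynomial.Derivation
import Mathlib.Algebra.Polynomial.Div
import Mathlib.RingTheory.Polynomial.Basic
import Mathlib.Tactic.LinearCombination
import Mathlib.Tactic.ReduceModChar
import HarnessLib

/-!
# [OURS · L1 W1.3] Reading R-flat, rung 1 — PRECISE FAILURE LOCUS: the §9.7 recipe's chain on the head
# `y² + x₁x₂⁵ + x₂⁴` (p = 2) has a tail whose square is NOT in `℘(Ě,1)`; the `q`-th-power-free chain on the same head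
# passes (seat res-L1-s13-pv-1)

LADDER-RESOLUTION rung L, cell `res-hironaka`, slot W1.3, campaign s13 (reading R-flat, director's RULING
2026-08-26T20:36:49Z (2); rung 1 = «`y(e)^q ∈ ℘(Ě,1)` for EVERY LL-chain at every level», K1.3 §4). The seat's census (kit
jobs j263239 / j263697, script HOME/L/res-L1-s13-pv-1/w13_census.py: the §9.7 recipe as read by K1.3, over 𝔽₂/𝔽₃/𝔽₅,
12 255 heads) found the rung-1 statement FALSE AS A ∀-STATEMENT and located the failure: the knock-out
`H♭ = u₀⁻¹·∂^{(α+pβ)}ε·∂^{(qγ₀)}ε` (Rem 9.9, case (I)) drags along `q`-th-POWER terms of `ε` that are not in `℘(Ě,1)`, so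
the recipe's tail has `y(e)^q ∉ ℘(Ě,1)`, while the chain absorbing the `q`-th powers into the tail (same head, same
cotangent vector) satisfies POS. This file certifies the smallest such head in the kernel.

THE HEAD. `K` any field of characteristic 2, `O = K[x₁,x₂,y]` (`X 0 = x₁`, `X 1 = x₂`, `X 2 = y`), `g = y² + ε`,
`ε = x₁x₂⁵ + x₂⁴` (`ord ε = 4 > q = 2`; frontier residue `α = (1,1) ≠ 0` so `ε ∉ ρ(O)`; `ε ∈ K[x₁,x₂]` is `g`-cleaned,
Def 7.18 p.41), `Ě = ((g), 2)` (hypersurface model, as in K1.3), `Sing(Ě) = {x₂ = y = 0}`.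
RECIPE (Eq. (76)/(77), Lem 9.6, Rem 9.9): `α = (1,1)`, `β = 0`, `γ₀ = (0,2)`, `|qγ₀| = 4 ≥ 2q` ⇒ case (I),
`H♭(ε) = ∂^{(1,1)}ε · ∂^{(0,4)}ε = x₂⁴ · (x₁x₂ + 1) = ε` (`N_recipe`; the factor `∂^{(0,4)}ε = x₁x₂ + 1` is a UNIT —
the «junk» contributed by the lower-residue term `x₂⁴`), so `h(0) = ε`, `g − h(0) = y²`, `g(1) = y(1) = y`: tail `y`,
with all printed clauses of Eq. (83) in order (`ord h(0) = 4 ≥ q + 1`, `= λ(0)`; `ε − h(0) = 0 ∈ ρ(𝔪)`; `y(1) − y = 0`).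
FAILURE (`N_tail_sq_not_mem`): `y² ∉ ℘(Ě,1)` for the BOUND ALGEBRAIC `℘` (`Campaign.pAlgPiece K (g) 2 1` = degree-1 piece
of the integral closure of `O[⊕_{j<2} Diff^{(j)}((g))·X^{2−j}]`, row 003 U17_2): along the arc `γ(t) = (t, t, t² + t³)`
one has `g∘γ = 0`, `∂₁g∘γ = ∂₂g∘γ = t⁵`, `∂_y g = 0`, so the whole Diff-subalgebra maps into the Rees algebra
`K[t][t⁵X] ⊆ K[t][X]`, which is integrally closed in `K[t][X]` (tree `Literature.RingTheory.IntegralClosure.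
mem_twistSubalgebra_of_isIntegral_twist`, Huneke–Swanson 5.2.1/1.5.2); but `y²∘γ = t⁴ + t⁶` is not divisible by `t⁵`.
Hence `¬ RFlatTailPow 2 K ((g),2) d` for EVERY chain datum `d` with `d.e = 1` and tail `y` (`N_not_rFlatTailPow`): the
recipe's tail is LOST by the R-flat cotangent module. REPAIR (`N_clean_rFlatTailPow`): the chain with knock-out
`h′(0) = x₁x₂⁵ = x₁·∂₁g` (the `q`-th power `x₂⁴` absorbed: `g − h′(0) = (y + x₂²)²`, tail `y + x₂²`, same cotangent vector
`ȳ` since `x₂² ∈ 𝔪²`) HAS `(y + x₂²)² ∈ ℘(Ě,1)`. So «POS for every LL-chain» fails exactly on the chain choice; «POS for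
the `q`-th-power-free chain» holds here (and on all 12 255 census heads no counterexample to the latter was found — see
the seat's census report; that general statement stays OPEN).

HONEST FRAMING. Nothing here is a statement of H. Hironaka's manuscript [Hironaka2017] (2017-03-23); Rem 9.9 /
Def 9.12 p.51 and Eq. (83)–(85) pp.54–56 are CANDIDATES [claim: Hironaka2017, status: under-review] used only to FIX
WHICH polynomials are computed; the identification of the bound algebraic `℘` with the geometric one (candidate U17_4)
is NOT used. This concerns OUR reading R-flat on the hypersurface model; it does not say the manuscript's `𝔗♯` (with
`℘nega`) loses the tail; RESCUE-SEED's caveat stands (any R-flat finding leaves L-G4 / (127) open; barrier of record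
`KangarooShadeIncrease.Hauser2003_kangarooShadeIncrease`). AI computation is weaker than expert review; nothing here is
progress on resolution of singularities in positive characteristic.

CONTENTS (all `[folklore]`, sorry-free): §1 order-one operators (`apply_mul_of_isDiffOpLE_one`,
`derivation_finset_sum_apply`, `derivation_eq_sum_smul_pderiv`, `derivation_apply_eq_sum`,
`map_diffIdeal_one_span_singleton_mem`: a ring map killing `g` with every `φ(∂_i g) ∈ I′` maps `Diff^{(1)}((g))` into
`I′`); §2 the arc criterion (`map_diffSubalgebra_mem_twist`, `not_mem_pAlgPiece_one_of_arc`: `φ(g) = 0`,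
`θ ∣ φ(∂_i g)` ∀ i, `θ ≠ 0`, `θ ∤ φ(c)` ⇒ `c ∉ ℘(((g),2),1)` bound); §3 the head (`N_taylor`, `N_recipe`, `N_pderiv`, `N_arc`, `N_tail_sq_not_mem`, `N_not_rFlatTailPow`, `N_clean_tail_sq`,
`N_clean_tail_sq_mem`, `N_clean_rFlatTailPow`, `N_tails_agree_mod_msq`).
-/

noncomputable section

set_option linter.dupNamespace false -- mandated namespace of this single-conjunct summit

namespace Summit.ResolutionOfSingularities.ResolutionOfSingularities.Theorems.Campaign.W13

open MvPolynomial
open Literature.AlgebraicGeometry.Resolution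
open Literature.AlgebraicGeometry.Hironaka2017
open Literature.AlgebraicGeometry.Hironaka2017.S04CharAlgebra (diffSubalgebra pAlgebraicRing)
open Literature.AlgebraicGeometry.Hironaka2017.S09LLUED (LLChainData)
open Literature.RingTheory.IntegralClosure (twistSubalgebra mem_twistSubalgebra_iff
  mem_twistSubalgebra_of_isIntegral_twist)

universe u

/-! ## §1 Differential operators of order `≤ 1` on a polynomial ring -/

section OrderOne

variable {R : Type*} {A : Type*} [CommSemiring R] [CommRing A] [Algebra R A]

/-- An operator of order `≤ 1` (EGA IV 16.8.8) satisfies `D(ab) = a·Db + b·Da − ab·D1`: its commutator with `a` is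
the multiplication by `Da − a·D1`. [folklore] -/
theorem apply_mul_of_isDiffOpLE_one {D : A →ₗ[R] A} (hD : IsDiffOpLE R 1 D) (a b : A) :
    D (a * b) = a * D b + b * D a - a * b * D 1 := by
  have h0 : IsDiffOpLE R 0 (commMul R D a) := (isDiffOpLE_succ_iff R).mp hD a
  have h1 := congrArg (fun L : A →ₗ[R] A => L b) (isDiffOpLE_zero_iff_eq_mulLeft.mp h0)
  simp only [commMul_apply, LinearMap.mulLeft_apply, mul_one] at h1
  linear_combination h1

end OrderOne

section PolyOrderOne

variable (K : Type u) [CommRing K] {σ : Type} [Fintype σ]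

omit [Fintype σ] in
/-- Evaluation of a finite sum of derivations (pointwise). [folklore] -/
theorem derivation_finset_sum_apply {ι : Type*} (s : Finset ι)
    (D : ι → Derivation K (MvPolynomial σ K) (MvPolynomial σ K)) (a : MvPolynomial σ K) :
    (∑ i ∈ s, D i) a = ∑ i ∈ s, D i a := by
  classical
  induction s using Finset.induction_on with
  | empty => simp
  | insert i s hi ih => rw [Finset.sum_insert hi, Finset.sum_insert hi, Derivation.add_apply, ih]

/-- On a polynomial ring a derivation is determined by its values on the variables:
`δ = Σ_i δ(x_i)·∂_i` (Mathlib `MvPolynomial.derivation_ext`). [folklore] -/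
theorem derivation_eq_sum_smul_pderiv (δ : Derivation K (MvPolynomial σ K) (MvPolynomial σ K)) :
    δ = ∑ i, δ (X i) • (pderiv i : Derivation K (MvPolynomial σ K) (MvPolynomial σ K)) := by
  apply MvPolynomial.derivation_ext
  intro j
  rw [derivation_finset_sum_apply, Finset.sum_eq_single j]
  · rw [Derivation.smul_apply, pderiv_X_self, smul_eq_mul, mul_one]
  · intro i _ hij
    rw [Derivation.smul_apply, pderiv_X_of_ne (Ne.symm hij), smul_zero]
  · intro hj; exact absurd (Finset.mem_univ j) hj

/-- `δ q = Σ_i δ(x_i)·∂_i q` for a derivation of a polynomial ring in finitely many variables. [folklore] -/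
theorem derivation_apply_eq_sum (δ : Derivation K (MvPolynomial σ K) (MvPolynomial σ K)) (q : MvPolynomial σ K) :
    δ q = ∑ i, δ (X i) * pderiv i q := by
  have h := DFunLike.congr_fun (derivation_eq_sum_smul_pderiv K δ) q
  rw [h, derivation_finset_sum_apply]
  simp [Derivation.smul_apply, smul_eq_mul]

/-- An order-`≤ 1` operator on a polynomial ring is `D = (D1)· + Σ_i c_i ∂_i` with `c_i = D(x_i) − x_i·D1`; in
particular `Dg ∈ (g, ∂_1 g, …, ∂_n g)`. Stated in the form used below: a ring map `φ` with `φ(g) ∈ I′` and all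
`φ(∂_i g) ∈ I′` maps `Diff^{(1)}((g))` (tree `Resolution.diffIdeal K 1`) into `I′`. [folklore] -/
theorem map_diffIdeal_one_span_singleton_mem {S : Type*} [CommRing S] (φ : MvPolynomial σ K →+* S) (I' : Ideal S)
    (g : MvPolynomial σ K) (hg : φ g ∈ I') (hd : ∀ i, φ (pderiv i g) ∈ I') :
    ∀ f ∈ diffIdeal K 1 (Ideal.span {g}), φ f ∈ I' := by
  intro f hf
  have key : diffIdeal K 1 (Ideal.span {g}) ≤ I'.comap φ := by
    refine (diffIdeal_le_iff K).mpr fun D hD f hf => ?_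
    obtain ⟨a, rfl⟩ := Ideal.mem_span_singleton'.mp hf
    -- the derivation part of `D`
    let δ : Derivation K (MvPolynomial σ K) (MvPolynomial σ K) :=
      { toLinearMap := D - LinearMap.mulLeft K (D 1)
        map_one_eq_zero' := by simp
        leibniz' := by
          intro p q
          simp only [LinearMap.sub_apply, LinearMap.mulLeft_apply, smul_eq_mul,
            apply_mul_of_isDiffOpLE_one hD p q]
          ring }
    have hδ : ∀ q, D q = D 1 * q + ∑ i, δ (X i) * pderiv i q := by
      intro q
      have h1 : δ q = ∑ i, δ (X i) * pderiv i q := derivation_apply_eq_sum K δ q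
      have h2 : δ q = D q - D 1 * q := rfl
      rw [← h1, h2]; ring
    rw [Ideal.mem_comap, hδ (a * g), map_add]
    refine I'.add_mem ?_ ?_
    · rw [map_mul, map_mul]
      exact I'.mul_mem_left _ (I'.mul_mem_left _ hg)
    · rw [map_sum]
      refine I'.sum_mem fun i _ => ?_
      rw [map_mul, Derivation.leibniz, smul_eq_mul, smul_eq_mul, map_add, map_mul, map_mul]
      exact I'.mul_mem_left _ (I'.add_mem (I'.mul_mem_left _ (hd i)) (I'.mul_mem_right _ hg))
  exact key hf

end PolyOrderOne

/-! ## §2 The arc criterion for `℘(((g),2), 1)` (bound, algebraic) -/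

section Arc

open Polynomial

variable (K : Type u) [Field K] {σ : Type} [Fintype σ]

/-- If a ring map `φ : K[x] → K[t]` kills `g` and sends every `∂_i g` into `(θ)`, then it maps the Diff-subalgebra
`O[⊕_{j<2} Diff^{(j)}((g)) X^{2−j}]` of `Ě = ((g), 2)` (row 003 `diffSubalgebra`) into the Rees algebra `K[t][θX]`
(tree `twistSubalgebra θ`: `θ^a ∣ coeff_a`). [folklore] -/
theorem map_diffSubalgebra_mem_twist (φ : MvPolynomial σ K →+* K[X]) (θ : K[X]) (g : MvPolynomial σ K)
    (hg : φ g = 0) (hd : ∀ i, θ ∣ φ (pderiv i g)) :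
    ∀ b ∈ diffSubalgebra K (MvPolynomial σ K) (Ideal.span {g}) 2,
      Polynomial.map φ b ∈ twistSubalgebra θ := by
  intro b hb
  induction hb using Algebra.adjoin_induction with
  | mem x hx =>
    obtain ⟨j, hj, c, hc, rfl⟩ := hx
    rw [Polynomial.map_monomial, mem_twistSubalgebra_iff]
    intro a
    rw [Polynomial.coeff_monomial]
    split_ifs with h
    · subst h
      interval_cases j
      · -- `j = 0`: `c ∈ (g)`, `φ c = 0`
        rw [diffIdeal_zero] at hc
        obtain ⟨a, rfl⟩ := Ideal.mem_span_singleton'.mp hc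
        simp [hg]
      · -- `j = 1`: `c ∈ Diff^{(1)}((g))`, `θ ∣ φ c`
        have hmem := map_diffIdeal_one_span_singleton_mem K φ (Ideal.span {θ}) g
          (by rw [hg]; exact Ideal.zero_mem _) (fun i => Ideal.mem_span_singleton.mpr (hd i)) c hc
        simpa using Ideal.mem_span_singleton.mp hmem
    · exact dvd_zero _
  | algebraMap r =>
    rw [Polynomial.algebraMap_apply, Polynomial.map_C, mem_twistSubalgebra_iff]
    intro a
    rw [Polynomial.coeff_C]
    split_ifs with h
    · subst h; simp
    · exact dvd_zero _
  | add x y _ _ hx hy => rw [Polynomial.map_add]; exact Subalgebra.add_mem _ hx hy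
  | mul x y _ _ hx hy => rw [Polynomial.map_mul]; exact Subalgebra.mul_mem _ hx hy

/-- **Arc criterion (NEG certificate), kernel form.** With `φ`, `θ ≠ 0`, `g` as above: an element `c` with
`θ ∤ φ(c)` is NOT in `℘(((g),2), 1)` (bound algebraic `℘` = degree-1 piece of the integral closure of the
Diff-subalgebra in `O[X]`): otherwise `c·X`, integral over the Diff-subalgebra, would map to an element of `K[t][X]`
integral over `K[t][θX]`, hence in `K[t][θX]` (Huneke–Swanson 5.2.1/1.5.2, tree
`mem_twistSubalgebra_of_isIntegral_twist`), forcing `θ ∣ φ(c)`. [folklore] -/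
theorem not_mem_pAlgPiece_one_of_arc (φ : MvPolynomial σ K →+* K[X]) {θ : K[X]} (hθ : θ ≠ 0)
    (g : MvPolynomial σ K) (hg : φ g = 0) (hd : ∀ i, θ ∣ φ (pderiv i g)) {c : MvPolynomial σ K}
    (hc : ¬ θ ∣ φ c) : c ∉ Campaign.pAlgPiece K (Ideal.span {g}) 2 1 := by
  intro hmem
  rw [mem_pAlgPiece_iff, pAlgebraicRing, Subalgebra.mem_restrictScalars, mem_integralClosure_iff] at hmem
  -- transport the integral equation along `ψ = Polynomial.map φ`
  set D := diffSubalgebra K (MvPolynomial σ K) (Ideal.span {g}) 2 with hD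
  let ψ : (MvPolynomial σ K)[X] →+* K[X][X] := Polynomial.mapRingHom φ
  have hψD : ∀ b : D, ψ (b : (MvPolynomial σ K)[X]) ∈ twistSubalgebra θ := fun b =>
    map_diffSubalgebra_mem_twist K φ θ g hg hd b b.2
  let ρ : D →+* twistSubalgebra θ :=
    (ψ.comp (Subalgebra.val D).toRingHom).codRestrict (twistSubalgebra θ).toSubring.toSubsemiring
      (fun b => hψD b)
  have hρ : ∀ b : D, ((ρ b : twistSubalgebra θ) : K[X][X]) = ψ (b : (MvPolynomial σ K)[X]) := fun b => rfl
  obtain ⟨P, hPmonic, hPx⟩ := hmem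
  have hint : IsIntegral (twistSubalgebra θ) (ψ (monomial 1 c)) := by
    refine ⟨P.map ρ, hPmonic.map ρ, ?_⟩
    have h1 : (algebraMap (twistSubalgebra θ) K[X][X]).comp ρ =
        ψ.comp (algebraMap D (MvPolynomial σ K)[X]) := RingHom.ext fun b => hρ b
    rw [Polynomial.eval₂_map, h1, ← Polynomial.hom_eval₂, hPx, map_zero]
  have hψx : ψ (monomial 1 c) ∈ twistSubalgebra θ := mem_twistSubalgebra_of_isIntegral_twist hθ hint
  have := (mem_twistSubalgebra_iff.mp hψx) 1
  rw [show ψ (monomial 1 c) = monomial 1 (φ c) from Polynomial.map_monomial φ, Polynomial.coeff_monomial,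
    if_pos rfl, pow_one] at this
  exact hc this

end Arc

/-! ## §3 The head `g = y² + x₁x₂⁵ + x₂⁴`, `p = 2`, `Ě = ((g), 2)` -/

section HeadN

open Polynomial

variable (K : Type) [Field K] [CharP K 2]

/-- Taylor expansion of `ε = x₁x₂⁵ + x₂⁴` in characteristic 2 — read off the Hasse derivatives the recipe uses:
`∂₁ε = x₂⁵`, `∂₂ε = x₁x₂⁴`, `∂^{(1,1)}ε = x₂⁴` (coefficient of `uv`), `∂^{(0,4)}ε = x₁x₂ + 1` (coefficient of `v⁴`).
[folklore] -/
theorem N_taylor (x₁ x₂ u v : K) :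
    (x₁ + u) * (x₂ + v) ^ 5 + (x₂ + v) ^ 4 =
      (x₁ * x₂ ^ 5 + x₂ ^ 4) + x₂ ^ 5 * u + x₁ * x₂ ^ 4 * v + x₂ ^ 4 * (u * v)
        + x₁ * x₂ * v ^ 4 + v ^ 4 + x₂ * (u * v ^ 4) + x₁ * v ^ 5 + u * v ^ 5 := by
  ring_nf
  reduce_mod_char!

omit [CharP K 2] in
/-- The §9.7 RECIPE on this head (frontier `x₁x₂⁵`, `α = (1,1)`, `β = 0`, `γ₀ = (0,2)`, `|qγ₀| = 4 ≥ 2q`: case (I),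
Rem 9.9): `H♭(ε) = ∂^{(1,1)}ε · ∂^{(0,4)}ε = x₂⁴·(x₁x₂ + 1) = ε` — the unit `x₁x₂ + 1` re-inserts the square `x₂⁴` into
the knock-out; and `g − H♭ = y²`: tail `y`. [folklore] -/
theorem N_recipe (x₁ x₂ y : K) :
    x₂ ^ 4 * (x₁ * x₂ + 1) = x₁ * x₂ ^ 5 + x₂ ^ 4 ∧
      (y ^ 2 + (x₁ * x₂ ^ 5 + x₂ ^ 4)) - (x₁ * x₂ ^ 5 + x₂ ^ 4) = y ^ 2 := by
  constructor <;> ring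

/-- First derivatives of the head `g = y² + x₁x₂⁵ + x₂⁴` (`X 0 = x₁`, `X 1 = x₂`, `X 2 = y`), characteristic 2:
`∂₁g = x₂⁵`, `∂₂g = x₁x₂⁴`, `∂_y g = 0`. [folklore] -/
theorem N_pderiv :
    pderiv 0 (MvPolynomial.X 2 ^ 2 + MvPolynomial.X 0 * MvPolynomial.X 1 ^ 5 + MvPolynomial.X 1 ^ 4 :
        MvPolynomial (Fin 3) K) = MvPolynomial.X 1 ^ 5 ∧
      pderiv 1 (MvPolynomial.X 2 ^ 2 + MvPolynomial.X 0 * MvPolynomial.X 1 ^ 5 + MvPolynomial.X 1 ^ 4 :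
        MvPolynomial (Fin 3) K) = MvPolynomial.X 0 * MvPolynomial.X 1 ^ 4 ∧
      pderiv 2 (MvPolynomial.X 2 ^ 2 + MvPolynomial.X 0 * MvPolynomial.X 1 ^ 5 + MvPolynomial.X 1 ^ 4 :
        MvPolynomial (Fin 3) K) = 0 := by
  have h2 : (2 : MvPolynomial (Fin 3) K) = 0 := CharTwo.two_eq_zero
  have h10 : (1 : Fin 3) ≠ 0 := by decide
  have h20 : (2 : Fin 3) ≠ 0 := by decide
  have h01 : (0 : Fin 3) ≠ 1 := by decide
  have h21 : (2 : Fin 3) ≠ 1 := by decide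
  have h02 : (0 : Fin 3) ≠ 2 := by decide
  have h12 : (1 : Fin 3) ≠ 2 := by decide
  refine ⟨?_, ?_, ?_⟩
  · simp only [map_add, pderiv_mul, pderiv_pow, pderiv_X_self, pderiv_X_of_ne h10, pderiv_X_of_ne h20, mul_zero,
      zero_add, add_zero, one_mul]
  · simp only [map_add, pderiv_mul, pderiv_pow, pderiv_X_self, pderiv_X_of_ne h01, pderiv_X_of_ne h21, mul_zero,
      zero_add, mul_one, zero_mul]
    push_cast
    linear_combination (2 * MvPolynomial.X 0 * MvPolynomial.X 1 ^ 4 + 2 * MvPolynomial.X 1 ^ 3 :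
      MvPolynomial (Fin 3) K) * h2
  · simp only [map_add, pderiv_mul, pderiv_pow, pderiv_X_self, pderiv_X_of_ne h02, pderiv_X_of_ne h12, mul_zero,
      add_zero, mul_one, zero_mul]
    push_cast
    linear_combination (MvPolynomial.X 2 : MvPolynomial (Fin 3) K) * h2

/-- The ARC `γ(t) = (x₁, x₂, y) = (t, t, t² + t³)` (`y(t)` = the square root of the square part `t⁴ + t⁶` of
`ε(t,t) = t⁶ + t⁴`): `g∘γ = 0`, `∂₁g∘γ = t⁵`, `∂₂g∘γ = t⁵`, `∂_y g∘γ = 0`, and `y²∘γ = t⁴ + t⁶`. [folklore] -/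
theorem N_arc :
    MvPolynomial.aeval ![(Polynomial.X : K[X]), Polynomial.X, Polynomial.X ^ 2 + Polynomial.X ^ 3]
        (MvPolynomial.X 2 ^ 2 + MvPolynomial.X 0 * MvPolynomial.X 1 ^ 5 + MvPolynomial.X 1 ^ 4 :
          MvPolynomial (Fin 3) K) = 0 ∧
      MvPolynomial.aeval ![(Polynomial.X : K[X]), Polynomial.X, Polynomial.X ^ 2 + Polynomial.X ^ 3]
        (MvPolynomial.X 1 ^ 5 : MvPolynomial (Fin 3) K) = Polynomial.X ^ 5 ∧
      MvPolynomial.aeval ![(Polynomial.X : K[X]), Polynomial.X, Polynomial.X ^ 2 + Polynomial.X ^ 3]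
        (MvPolynomial.X 0 * MvPolynomial.X 1 ^ 4 : MvPolynomial (Fin 3) K) = Polynomial.X ^ 5 ∧
      MvPolynomial.aeval ![(Polynomial.X : K[X]), Polynomial.X, Polynomial.X ^ 2 + Polynomial.X ^ 3]
        (MvPolynomial.X 2 ^ 2 : MvPolynomial (Fin 3) K) = Polynomial.X ^ 4 + Polynomial.X ^ 6 := by
  have h2 : (2 : K[X]) = 0 := CharTwo.two_eq_zero
  refine ⟨?_, ?_, ?_, ?_⟩
  · simp only [map_add, map_pow, map_mul, MvPolynomial.aeval_X, Matrix.cons_val_zero, Matrix.cons_val_one,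
      Matrix.cons_val_two, Matrix.tail_cons, Matrix.head_cons]
    linear_combination (Polynomial.X ^ 5 + Polynomial.X ^ 4 + Polynomial.X ^ 6 : K[X]) * h2
  · simp only [map_pow, MvPolynomial.aeval_X, Matrix.cons_val_one, Matrix.cons_val_zero]
  · simp only [map_pow, map_mul, MvPolynomial.aeval_X, Matrix.cons_val_zero, Matrix.cons_val_one]
    ring
  · simp only [map_pow, MvPolynomial.aeval_X, Matrix.cons_val_two, Matrix.tail_cons, Matrix.head_cons]
    linear_combination (Polynomial.X ^ 5 : K[X]) * h2

/-- **FAILURE of POS for the recipe's tail**: `y² ∉ ℘(Ě,1)` (bound algebraic), `Ě = ((y² + x₁x₂⁵ + x₂⁴), 2)`,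
`p = 2` — by the arc criterion with `γ = (t, t, t²+t³)`, `θ = t⁵`: `t⁵ ∤ t⁴ + t⁶`. [folklore] -/
theorem N_tail_sq_not_mem :
    (MvPolynomial.X 2 : MvPolynomial (Fin 3) K) ^ 2 ∉
      Campaign.pAlgPiece K (Ideal.span {(MvPolynomial.X 2 ^ 2 + MvPolynomial.X 0 * MvPolynomial.X 1 ^ 5 +
        MvPolynomial.X 1 ^ 4 : MvPolynomial (Fin 3) K)}) 2 1 := by
  obtain ⟨hg, h1, h2, hy⟩ := N_arc K
  obtain ⟨d0, d1, d2⟩ := N_pderiv K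
  refine not_mem_pAlgPiece_one_of_arc K
    (MvPolynomial.aeval ![(Polynomial.X : K[X]), Polynomial.X, Polynomial.X ^ 2 + Polynomial.X ^ 3]).toRingHom
    (θ := Polynomial.X ^ 5) (pow_ne_zero 5 Polynomial.X_ne_zero) _ hg ?_ ?_
  · intro i
    fin_cases i
    · change Polynomial.X ^ 5 ∣ MvPolynomial.aeval _ (pderiv 0 _); rw [d0, h1]
    · change Polynomial.X ^ 5 ∣ MvPolynomial.aeval _ (pderiv 1 _); rw [d1, h2]
    · change Polynomial.X ^ 5 ∣ MvPolynomial.aeval _ (pderiv 2 _); rw [d2, map_zero]; exact dvd_zero _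
  · change ¬ Polynomial.X ^ 5 ∣ MvPolynomial.aeval _ (MvPolynomial.X 2 ^ 2)
    rw [hy, Polynomial.X_pow_dvd_iff]
    intro h
    have h4 := h 4 (by norm_num)
    rw [Polynomial.coeff_add, Polynomial.coeff_X_pow, Polynomial.coeff_X_pow, if_pos rfl, if_neg (by norm_num),
      add_zero] at h4
    exact (one_ne_zero (α := K)) h4

/-- **PRECISE FAILURE LOCUS of rung 1 as a ∀-statement**: for the head `y² + x₁x₂⁵ + x₂⁴`, `p = 2`, v4's schema
`RFlatTailPow 2 K ((g),2) d` FAILS for every chain datum `d` with exponent `e = 1` and tail `y` — in particular for the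
§9.7 recipe's chain (`N_recipe`; the clauses of Eq. (83) hold trivially: `ε − h(0) = 0 ∈ ρ(𝔪)`, `h(0) ∈ 𝔪³`). The R-flat cotangent module loses this tail. [folklore] -/
theorem N_not_rFlatTailPow (d : LLChainData (MvPolynomial (Fin 3) K)) (hde : d.e = 1)
    (hdt : d.tail = MvPolynomial.X 2) :
    ¬ Campaign.RFlatTailPow 2 K (Ideal.span {(MvPolynomial.X 2 ^ 2 + MvPolynomial.X 0 * MvPolynomial.X 1 ^ 5 +
        MvPolynomial.X 1 ^ 4 : MvPolynomial (Fin 3) K)}) 2 d := by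
  rw [Campaign.RFlatTailPow, hdt, hde]
  simpa using N_tail_sq_not_mem K

/-- The REPAIRED chain on the same head: knock-out `h′(0) = x₁x₂⁵ = x₁·∂₁g` only (the square `x₂⁴` absorbed into the
tail): `(y + x₂²)² = g + x₁·∂₁g` in characteristic 2, tail `y + x₂²`. [folklore] -/
theorem N_clean_tail_sq :
    (MvPolynomial.X 2 + MvPolynomial.X 1 ^ 2 : MvPolynomial (Fin 3) K) ^ 2 =
      (MvPolynomial.X 2 ^ 2 + MvPolynomial.X 0 * MvPolynomial.X 1 ^ 5 + MvPolynomial.X 1 ^ 4) +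
        MvPolynomial.X 0 * pderiv 0 (MvPolynomial.X 2 ^ 2 + MvPolynomial.X 0 * MvPolynomial.X 1 ^ 5 +
          MvPolynomial.X 1 ^ 4 : MvPolynomial (Fin 3) K) := by
  rw [(N_pderiv K).1]
  have h2 : (2 : MvPolynomial (Fin 3) K) = 0 := CharTwo.two_eq_zero
  linear_combination (MvPolynomial.X 2 * MvPolynomial.X 1 ^ 2 - MvPolynomial.X 0 * MvPolynomial.X 1 ^ 5 :
    MvPolynomial (Fin 3) K) * h2

/-- POS for the repaired tail: `(y + x₂²)² ∈ ℘(Ě,1)` (bound; via `Diff^{(1)}((g)) ⊆ ℘(Ě,1)`). [folklore] -/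
theorem N_clean_tail_sq_mem :
    (MvPolynomial.X 2 + MvPolynomial.X 1 ^ 2 : MvPolynomial (Fin 3) K) ^ 2 ^ 1 ∈
      Campaign.pAlgPiece K (Ideal.span {(MvPolynomial.X 2 ^ 2 + MvPolynomial.X 0 * MvPolynomial.X 1 ^ 5 +
        MvPolynomial.X 1 ^ 4 : MvPolynomial (Fin 3) K)}) 2 1 := by
  rw [pow_one, N_clean_tail_sq]
  refine diffIdeal_le_pAlgPiece_one K _ (by norm_num) (show 1 < 2 by norm_num) ?_
  exact Ideal.add_mem _ (le_diffIdeal K 1 _ (Ideal.subset_span rfl)) (mul_pderiv_mem_diffIdeal K 0 _ _ le_rfl)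

/-- … hence `RFlatTailPow 2 K ((g),2) d` HOLDS for every chain datum with `e = 1` and the repaired tail `y + x₂²`:
on this head the rung-1 condition depends on the CHAIN, not on the head. [folklore] -/
theorem N_clean_rFlatTailPow (d : LLChainData (MvPolynomial (Fin 3) K)) (hde : d.e = 1)
    (hdt : d.tail = MvPolynomial.X 2 + MvPolynomial.X 1 ^ 2) :
    Campaign.RFlatTailPow 2 K (Ideal.span {(MvPolynomial.X 2 ^ 2 + MvPolynomial.X 0 * MvPolynomial.X 1 ^ 5 +
        MvPolynomial.X 1 ^ 4 : MvPolynomial (Fin 3) K)}) 2 d :=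
  rFlatTailPow_of_pow_mem (N_clean_tail_sq_mem K) d hde hdt

omit [CharP K 2] in
/-- The two tails define the same cotangent vector: `(y + x₂²) − y = x₂² ∈ 𝔪²`, `𝔪 = (x₁, x₂, y)` the ideal of the
origin (Mathlib `MvPolynomial.idealOfVars`); so Th 9.18 (2)'s datum «`y(e)` mod `max(O_ξ)²`» does not see the
difference, only the module `Cot` does. [folklore] -/
theorem N_tails_agree_mod_msq :
    (MvPolynomial.X 2 + MvPolynomial.X 1 ^ 2 : MvPolynomial (Fin 3) K) - MvPolynomial.X 2 ∈
      (MvPolynomial.idealOfVars (Fin 3) K) ^ 2 := by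
  rw [add_sub_cancel_left, pow_two, pow_two]
  exact Ideal.mul_mem_mul (Ideal.subset_span ⟨1, rfl⟩) (Ideal.subset_span ⟨1, rfl⟩)

end HeadN

end Summit.ResolutionOfSingularities.ResolutionOfSingularities.Theorems.Campaign.W13

end
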